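import Mathlib
import HarnessLib
import Summits.AtomisticToContinuum.Crystallization.Theorems.FrustratedLawDichotomyTwoShellRigidityLsFitReplayDecode

/-!
# Two-shell rigidity, slot 3 · `SphericalLsFit` replay parameters (fcc) of the B-run of record

`prmFcc` = the integer parameters of the fcc fit run (brace level `B2 = ⌈7·S²/200⌉`; levels `F0L`, `OM2`, `V1K`, `V3K` = the extremes
certified over the 32 ω-sub-leaf fits — real readings α ≤ 0.08134, Ω ≤ 0.03339, V₁ ≤ 0.04302, V₃ ≤ 0.06392;
rational dial (α, Ω, V₁, V₃) = (821 / 10000, 167 / 5000, 431 / 10000, 8 / 125) for `sphericalLsFit_fcc_of_checkAllF'`).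
decomp-a2c census-1 g22, kit j345739, `rig_fitgen.py`.
-/

namespace Summit.AtomisticToContinuum.Crystallization.Theorems

namespace Rig

/-- Parameters of the fcc fit run of record (`β = 7/200`, `θ = 1/100`, probes `ptab26`). -/
def prmFcc : FitPrm :=
  ⟨46522979852472055551633247109812061, 1625082875722782235, 189667792577774894007363512647785418,
    ⟨581152053419716052, 1122318969777092411, 1140976653599927888⟩,
    ⟨940412606251684360, 1620859095308572171, 2042401160960539668⟩, ptab26⟩

end Rig

end Summit.AtomisticToContinuum.Crystallization.Theorems
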